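import Summits.QuantumFields.BalabanUV.Beta.SpineRootedSc
import Literature.MathematicalPhysics.QuantumFieldTheory.Balaban1983to89.Beta.BalabanStepJetsSucc
import Summits.QuantumFields.BalabanUV.Beta.AxialDressingRootedLegs

/-!
# The ROOTED first-order spine of Bałaban's step jets — part C: `e3AtOf ρ`, `SstepAt ρ`, the families `JsBal0AtOf` / `JsBalAtOf`

HONEST FRAMING (cell charter, verbatim): «discharging BetaPertH makes Balaban's UV stability UNCONDITIONAL — a real
constructive-QFT result; it is NOT the continuum limit and NOT the Clay problem.»  DERIVED cell leaf (pub-balaban β sub-cell, lane an2,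
work-order (P7′) stage ρ2; see part A `SpineRootedS0` for the why); no statement of Bałaban's papers is typed here, no `[cite:]` tag, no
`Prop` fact; NOT `BetaPertH`; NOT continuum; NOT Clay.

## What is here (decl-by-decl twin of `BalabanStepJetsSucc` §3, §5–§6, §8 with an1's ROOTED tables and an2's ROOTED dressing)

`e3AtOf ρ j` (the value-function third jet through BCJ's one-shot vertex of the ROOTED composite stencil `ScAt ρ (j−1)`; `KInv`, `mmRead`,
`E2`, `lamCoeffK`, `wE/wVH/wΛ` ROOT-FREE, by name), `locStencil_e3AtOf`, `SstepAt ρ j` (+ `locStencil_SstepAt`), the data `jsStepAtOf`,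
the families `JsBal0AtOf hLc hr …` (member `0` = part A's `jsBal0AtOf`) and **`JsBalAtOf hLc hr … := fun j ↦ dressAt hr (JsBal0AtOf … j)`**
— ONE root `ρ = toSite r` for an1's averaging tables AND for the axial-gauge dressing (`AxialDressingRooted.dressAt`, (P7′) ρ1): the
COHERENT rooted literal of route (α) over abstract second-order tables; the (St♭)/(Wt) sockets `JsBal0AtOf_S_translate`,
`JsBalAtOf_S_translate`, `JsBalAtOf_W_translate`, `JsBal0AtOf_W_translate`; bridges `e3AtOf_zero`, `SstepAt_zero`.

Provenance: b2b-balaban β sub-cell, unit beta-an2 gen 11, 2026-08-19 (v1); over parts A–B, `Beta.BalabanStepJetsSucc` (an2 lineage),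
`Beta.AveragingHessianKernelsRooted` (an1 lineage) and `Summits/…/Beta/AxialDressingRootedLegs` (an2, (P7′) ρ1) BY NAME; no existing file
touched.
-/

open Finset
open scoped BigOperators
open Literature.MathematicalPhysics.QuantumFieldTheory
open Literature.MathematicalPhysics.QuantumFieldTheory.Balaban1983to89
open Literature.MathematicalPhysics.QuantumFieldTheory.Balaban1983to89.Beta
open LatticeForm (quo proj_add_zsmul)
open BlochFibreUniqueness (quo_add_zsmul)
open B12Sec2to5 (l1 l1_nonneg)
open ExpKernelCalculus (Decays BiLoc VertexFamily VertexFamily₂ shiftK Zl Zl_nonneg l1_sub_triangle l1_sub_symm)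
open OneStepResolventKernel (Fib LocStencil JetData KInv decays_KInv shiftK_KInv biLoc_mono biLoc_finset_sum)
open AffineAveraging (Form1 Form2 box toSite)
open StepJetData (wilsonA wBound locStencil_wilsonA wilsonA_translate wilsonA_antisymm mfNeg mfNeg_shiftK locStencil_mfNeg
  mfNeg_antisymm locStencil_add locStencil_smul biLoc_smul biLoc_weaken l1_add_le)
open AveragingHessianKernels (vhS hessFF ell)
open AveragingHessianKernelsRooted (vhSAt locStencil_vhSAt vhSAt_translate vhSAt_symm hessFFAt hessFFAt_antisymm biLoc_hessFFAt
  hessFFAt_translate vhSAt_zero hessFFAt_zero)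
open InterLevelTransport (SLam locStencil_SLam SLam_translate cwsum avgLift biLoc_avgLift avgLift_shiftK)
open BalabanStepJets (lamCoeffOf abs_lamCoeffOf_le lamCoeffOf_translate cwsum_antisymm locStencil_mono vertexFamily₂_mono S0)
open ExpKernelCalculus (MKer comp comp_shiftK)
open OneStepResolventKernel (decays_mono vertexOf vertexFamily_vertexOf')
open OneStepKernelFamily (KInvStep decays_KInvStep shiftK_KInvStep TstepOf TbalOf)
open BalabanStepJetsSucc (mmRead E2 e3Of decays_E2 one_le_pow_Lc locStencil_e3Of lamCoeffK abs_lamCoeffK_le wE wVH wΛ Sstep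
  vertexOf_translate_block comp_sandwich_shiftK mmRead_shiftK_smul shiftK_E2 lamCoeffK_translate biLoc_comp_right biLoc_mmRead decays_mmRead)
open Summit.QuantumFields.BalabanUV.Beta.AxialDressingRooted (dressAt dressAt_S dressAt_W dressAtS_translate dressAtW_translate)

noncomputable section

namespace Summit.QuantumFields.BalabanUV.Beta.SpineRooted

variable {d : ℕ}

/-! ## §C1 The rooted value-function third jet `e3AtOf ρ j` -/

section ValueJets

variable (d) (Lc : ℕ) [NeZero Lc]

/-- [folklore] **THE ROOTED VALUE-FUNCTION THIRD JET** along the minimiser response (twin of `BalabanStepJetsSucc.e3Of`; the packed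
resolvent `KInv (Lc^j)` and the `mm`-read are ROOT-FREE, the root enters through BCJ's one-shot vertex of the ROOTED composite stencil
`ScAt ρ (j−1)`): `e3AtOf ρ j κ′ u′ := −mmRead (Lc^j) (KInv ∘ vertexOf (ScAt ρ (j−1)) κ′ u′ ∘ KInv)`. -/
def e3AtOf (ρ : Fin (d + 1) → ℤ) (cE cVH cΛ : ℝ) (j : ℕ) :
    Fin (d + 1) → (Fin (d + 1) → ℤ) → ExpKernelCalculus.MKer (d + 1) (Fib d) :=
  fun κ' u' x' z' a b =>
    -(mmRead (Lc ^ j)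
      (comp (comp (KInv (N := Lc ^ j) (d := d)) (vertexOf (N := Lc ^ j) (ScAt d Lc ρ cE cVH cΛ (j - 1)) κ' u'))
        (KInv (N := Lc ^ j) (d := d))) x' z' a b)

variable {d Lc}

/-- [folklore] **BRIDGE:** `e3AtOf 0 = BalabanStepJetsSucc.e3Of`. -/
theorem e3AtOf_zero (cE cVH cΛ : ℝ) (j : ℕ) : e3AtOf d Lc 0 cE cVH cΛ j = e3Of d Lc cE cVH cΛ j := by
  funext κ' u' x' z' a b
  simp only [e3AtOf, e3Of, ScAt_zero]

/-- [folklore] **`e3AtOf (toSite r) j` IS A LOCAL STENCIL FAMILY** on the step-`j` lattice (proof of `locStencil_e3Of` over `locStencil_ScAt`). -/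
theorem locStencil_e3AtOf (hLc : 1 ≤ Lc) {r : Fin (d + 1) → ℕ} (hr : r ∈ box (d + 1) Lc) (cE cVH cΛ : ℝ) (j : ℕ) :
    ∃ Cs δ : ℝ, 0 < δ ∧ LocStencil (e3AtOf d Lc (toSite r) cE cVH cΛ j) Cs δ := by
  obtain ⟨δK, CK, hδK, hCK, hK⟩ := decays_KInv (N := Lc ^ j) (d := d)
  obtain ⟨Cs, δs, hδs, hS⟩ := locStencil_ScAt (d := d) (Lc := Lc) hLc hr cE cVH cΛ (j - 1)
  obtain ⟨Cv, δv, hδv, hV⟩ := vertexFamily_vertexOf' (N := Lc ^ j) hS hδs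
  set m : ℝ := min δK δv with hm
  have hm0 : 0 < m := lt_min hδK hδv
  have hCv : 0 ≤ Cv := (hV 0 0).nonneg (Sum.inl 0)
  have hKm : Decays (KInv (N := Lc ^ j) (d := d)) CK m := decays_mono hK hCK le_rfl (min_le_left _ _)
  have hKm2 : Decays (KInv (N := Lc ^ j) (d := d)) CK (m / 2) := decays_mono hK hCK le_rfl (by linarith [min_le_left δK δv])
  refine ⟨(Fintype.card (Fib d) : ℝ) * (((Fintype.card (Fib d) : ℝ) * (CK * Cv) * Zl (d + 1) (m - m / 2)) * CK) *
      Zl (d + 1) (m / 2 - m / 4), m / 4, by positivity, fun κ' u' => ?_⟩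
  have hVm : BiLoc (vertexOf (N := Lc ^ j) (ScAt d Lc (toSite r) cE cVH cΛ (j - 1)) κ' u') ((((Lc ^ j : ℕ) : ℤ)) • u')
      ((((Lc ^ j : ℕ) : ℤ)) • u') Cv m := biLoc_mono (hV κ' u') hCv (min_le_right _ _)
  have h1 := ExpKernelCalculus.biLoc_comp_decays hKm hVm (show 0 ≤ m / 2 by positivity) (by linarith)
  have h2 := biLoc_comp_right h1 hKm2 (show 0 ≤ m / 4 by positivity) (by linarith)
  intro x' z' a b
  rw [show e3AtOf d Lc (toSite r) cE cVH cΛ j κ' u' x' z' a b = -(mmRead (Lc ^ j)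
      (comp (comp (KInv (N := Lc ^ j) (d := d)) (vertexOf (N := Lc ^ j) (ScAt d Lc (toSite r) cE cVH cΛ (j - 1)) κ' u'))
        (KInv (N := Lc ^ j) (d := d))) x' z' a b) from rfl, abs_neg]
  exact biLoc_mmRead (one_le_pow_Lc j) h2 (by positivity) x' z' a b

end ValueJets

/-! ## §C2 The rooted step stencils `SstepAt ρ j` (`j ≥ 1`) -/

section Step

variable (d) (Lc : ℕ) [NeZero Lc]

/-- [folklore] **BAŁABAN'S ROOTED STEP-`j` FIRST-ORDER STENCIL FAMILY** (twin of `BalabanStepJetsSucc.Sstep` with `e3AtOf ρ`, an1's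
`vhSAt ρ` and `hessFFAt ρ`; the weights `wE/wVH/wΛ`, the value Hessian `E2 j` and the step multiplier response
`lamCoeffK (KInvStep Lc j) (E2 j) Lc` are ROOT-FREE):
`SstepAt ρ j κ′ u′ := (cE·wE j) • e3AtOf ρ j κ′ u′ + (cVH·wVH j) • mfNeg (vhSAt ρ d Lc κ′ u′) + (cΛ·wΛ j) • SLam Lc (lamCoeffK …) (hessFFAt ρ Lc) κ′ u′`. -/
def SstepAt (ρ : Fin (d + 1) → ℤ) (cE cVH cΛ : ℝ) (j : ℕ) :
    Fin (d + 1) → (Fin (d + 1) → ℤ) → ExpKernelCalculus.MKer (d + 1) (Fib d) := fun κ' u' =>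
  (cE * wE d Lc j) • e3AtOf d Lc ρ cE cVH cΛ j κ' u' + (cVH * wVH d Lc j) • mfNeg (vhSAt ρ d Lc rfl κ' u') +
    (cΛ * wΛ d Lc j) • SLam Lc (lamCoeffK (KInvStep (d := d) Lc j) (E2 d Lc j) Lc) (fun μ y => hessFFAt ρ Lc μ y) κ' u'

variable {d Lc}

/-- [folklore] **BRIDGE:** `SstepAt 0 = BalabanStepJetsSucc.Sstep`. -/
theorem SstepAt_zero (cE cVH cΛ : ℝ) (j : ℕ) : SstepAt d Lc 0 cE cVH cΛ j = Sstep d Lc cE cVH cΛ j := by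
  funext κ' u'
  simp only [SstepAt, Sstep, e3AtOf_zero, vhSAt_zero, hessFFAt_zero]

/-- [folklore] **`SstepAt (toSite r) j` IS A LOCAL STENCIL FAMILY** (proof of `locStencil_Sstep` with an1's rooted lemmas). -/
theorem locStencil_SstepAt (hLc : 1 ≤ Lc) {r : Fin (d + 1) → ℕ} (hr : r ∈ box (d + 1) Lc) (cE cVH cΛ : ℝ) (j : ℕ) :
    ∃ Cs δ : ℝ, 0 < δ ∧ LocStencil (SstepAt d Lc (toSite r) cE cVH cΛ j) Cs δ := by
  obtain ⟨C₁, δ₁, hδ₁, h1⟩ := locStencil_e3AtOf (d := d) (Lc := Lc) hLc hr cE cVH cΛ j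
  obtain ⟨δA, CA, hδA, hCA, hA⟩ := decays_KInvStep (Lc := Lc) (d := d) j
  obtain ⟨δE, CE, hδE, hCE, hE⟩ := decays_E2 (d := d) (Lc := Lc) j
  set n : ℝ := min δA δE with hn
  have hn0 : 0 < n := lt_min hδA hδE
  have hA' : Decays (KInvStep (d := d) Lc j) CA n := decays_mono hA hCA le_rfl (min_le_left _ _)
  have hE' : Decays (E2 d Lc j) CE n := decays_mono hE hCE le_rfl (min_le_right _ _)
  have hc := abs_lamCoeffK_le hA' hE' hn0 Lc
  have hn2 : (0 : ℝ) ≤ n / 2 := by positivity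
  have hQ : VertexFamily (fun μ y => hessFFAt (toSite r) Lc μ y) Lc
      (2 * (ell (d + 1) Lc : ℝ) ^ 2 * Real.exp (4 * ((d : ℝ) + 1) * Lc * (n / 2))) (n / 2) :=
    fun μ y => biLoc_hessFFAt hLc μ y hr hn2
  have h3 := locStencil_SLam (N := Lc) hc hQ (by positivity)
    (mul_nonneg (mul_nonneg (Nat.cast_nonneg _) (mul_nonneg hCA hCE)) (Zl_nonneg (by linarith)))
  set r' : ℝ := min δ₁ (n / 2 / 2) with hr'
  have hr0 : 0 < r' := lt_min hδ₁ (by positivity)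
  have hC₁ : 0 ≤ C₁ := (h1 0 0).nonneg (Sum.inl 0)
  have h1r : LocStencil (e3AtOf d Lc (toSite r) cE cVH cΛ j) C₁ r' := locStencil_mono h1 hC₁ (min_le_left _ _)
  have h2r : LocStencil (fun κ' u => mfNeg (vhSAt (toSite r) d Lc rfl κ' u))
      (3 * (ell (d + 1) Lc : ℝ) ^ 2 * Real.exp (4 * ((d : ℝ) + 1) * Lc * r')) r' :=
    locStencil_mfNeg (locStencil_vhSAt hLc hr hr0.le)
  have h3r := locStencil_mono h3 ((h3 0 0).nonneg (Sum.inl 0)) (min_le_right δ₁ (n / 2 / 2))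
  exact ⟨_, r', hr0, locStencil_add (locStencil_add (locStencil_smul (cE * wE d Lc j) h1r)
    (locStencil_smul (cVH * wVH d Lc j) h2r)) (locStencil_smul (cΛ * wΛ d Lc j) h3r)⟩

end Step

/-! ## §C3 The rooted families `JsBal0AtOf` (undressed) and `JsBalAtOf := dressAt ρ ∘ JsBal0AtOf` (dressed, SAME root) -/

section Family

variable {Lc : ℕ} [NeZero Lc]

/-- [folklore] **THE ROOTED STEP-`j` JET DATUM** `(SstepAt (toSite r) j, W j)` (twin of `BalabanStepJetsSucc.jsStepOf`). -/
def jsStepAtOf (hLc : 1 ≤ Lc) {r : Fin (d + 1) → ℕ} (hr : r ∈ box (d + 1) Lc) (cE cVH cΛ : ℝ)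
    (W : ℕ → Fin (d + 1) → (Fin (d + 1) → ℤ) → Fin (d + 1) → (Fin (d + 1) → ℤ) → ExpKernelCalculus.MKer (d + 1) (Fib d))
    (Cw δw : ℕ → ℝ) (hδw : ∀ j, 0 < δw j) (hW : ∀ j, VertexFamily₂ (W j) Lc (Cw j) (δw j)) (j : ℕ) : JetData d Lc :=
  have hS := locStencil_SstepAt (d := d) (Lc := Lc) hLc hr cE cVH cΛ j
  have hδS : 0 < hS.choose_spec.choose := hS.choose_spec.choose_spec.1
  have hloc : LocStencil (SstepAt d Lc (toSite r) cE cVH cΛ j) hS.choose hS.choose_spec.choose := hS.choose_spec.choose_spec.2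
  { S := SstepAt d Lc (toSite r) cE cVH cΛ j
    W := W j
    Cs := hS.choose
    Cw := Cw j
    δ := min hS.choose_spec.choose (δw j)
    δ_pos := lt_min hδS (hδw j)
    loc := locStencil_mono hloc ((hloc 0 0).nonneg (Sum.inl 0)) (min_le_left _ _)
    loc₂ := vertexFamily₂_mono (hW j) ((hW j 0 0 0 0).nonneg (Sum.inl 0)) (min_le_right _ _) }

variable (hLc : 1 ≤ Lc) {r : Fin (d + 1) → ℕ} (hr : r ∈ box (d + 1) Lc) (cE cVH cΛ : ℝ)
    (W : ℕ → Fin (d + 1) → (Fin (d + 1) → ℤ) → Fin (d + 1) → (Fin (d + 1) → ℤ) → ExpKernelCalculus.MKer (d + 1) (Fib d))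
    (Cw δw : ℕ → ℝ) (hδw : ∀ j, 0 < δw j) (hW : ∀ j, VertexFamily₂ (W j) Lc (Cw j) (δw j))

/-- [folklore] The first-order table of the rooted step member `jsStepAtOf … j` is `SstepAt … (toSite r) … j`. -/
@[simp] theorem jsStepAtOf_S (j : ℕ) : (jsStepAtOf hLc hr cE cVH cΛ W Cw δw hδw hW j).S = SstepAt d Lc (toSite r) cE cVH cΛ j := rfl

/-- [folklore] The second-order table of the rooted step member `jsStepAtOf … j` is the supplied `W j`. -/
@[simp] theorem jsStepAtOf_W (j : ℕ) : (jsStepAtOf hLc hr cE cVH cΛ W Cw δw hδw hW j).W = W j := rfl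

/-- [folklore] **THE ROOTED UNDRESSED FAMILY `JsBal⁰_ρ`** (twin of `BalabanStepJetsSucc.JsBal0Of`): member `0` is `jsBal0AtOf`, member
`j+1` is `jsStepAtOf … (j+1)`; second-order tables `W j` abstract. -/
def JsBal0AtOf : ℕ → JetData d Lc
  | 0 => jsBal0AtOf hLc hr cE cVH cΛ (W 0) (Cw 0) (δw 0) (hδw 0) (hW 0)
  | j + 1 => jsStepAtOf hLc hr cE cVH cΛ W Cw δw hδw hW (j + 1)

/-- [folklore] **THE ROOTED DRESSED FAMILY `JsBal_ρ := dressAt ρ ∘ JsBal⁰_ρ`** — ONE root `ρ = toSite r` for the averaging tables AND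
the axial-gauge dressing (an2's `AxialDressingRooted.dressAt hr`): the COHERENT rooted literal of route (α). -/
def JsBalAtOf : ℕ → JetData d Lc := fun j => dressAt hr (JsBal0AtOf hLc hr cE cVH cΛ W Cw δw hδw hW j)

/-- [folklore] Member `0` of the rooted undressed family is `jsBal0AtOf` (closure lemma of the `match`). -/
theorem JsBal0AtOf_zero :
    JsBal0AtOf hLc hr cE cVH cΛ W Cw δw hδw hW 0 = jsBal0AtOf hLc hr cE cVH cΛ (W 0) (Cw 0) (δw 0) (hδw 0) (hW 0) := rfl

/-- [folklore] Member `j+1` of the rooted undressed family is `jsStepAtOf … (j+1)` (closure lemma of the `match`). -/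
theorem JsBal0AtOf_succ (j : ℕ) :
    JsBal0AtOf hLc hr cE cVH cΛ W Cw δw hδw hW (j + 1) = jsStepAtOf hLc hr cE cVH cΛ W Cw δw hδw hW (j + 1) := rfl

/-- [folklore] The first-order table of member `0` of the rooted undressed family is `S0At … (toSite r) …`. -/
@[simp] theorem JsBal0AtOf_S_zero : (JsBal0AtOf hLc hr cE cVH cΛ W Cw δw hδw hW 0).S = S0At d Lc (toSite r) cE cVH cΛ := rfl

/-- [folklore] The first-order table of member `j+1` of the rooted undressed family is `SstepAt … (toSite r) … (j+1)`. -/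
@[simp] theorem JsBal0AtOf_S_succ (j : ℕ) :
    (JsBal0AtOf hLc hr cE cVH cΛ W Cw δw hδw hW (j + 1)).S = SstepAt d Lc (toSite r) cE cVH cΛ (j + 1) := rfl

/-- [folklore] The second-order table of every member of the rooted undressed family is the supplied `W j`. -/
@[simp] theorem JsBal0AtOf_W : ∀ j : ℕ, (JsBal0AtOf hLc hr cE cVH cΛ W Cw δw hδw hW j).W = W j
  | 0 => rfl
  | _ + 1 => rfl

/-- [folklore] `JsBal_ρ` is `dressAt ρ ∘ JsBal⁰_ρ`, by definition. -/
theorem JsBalAtOf_apply (j : ℕ) :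
    JsBalAtOf hLc hr cE cVH cΛ W Cw δw hδw hW j = dressAt hr (JsBal0AtOf hLc hr cE cVH cΛ W Cw δw hδw hW j) := rfl

end Family

/-! ## §C4 The block-translation sockets (St♭)/(Wt) of `JsBal⁰_ρ` and `JsBal_ρ` (all in-block roots) -/

section Covariance

variable {Lc : ℕ} [NeZero Lc]

/-- [folklore] **THE ROOTED THIRD JET IS TRANSLATION COVARIANT ON THE STEP LATTICE** (members `j+1`; from `ScAt_translate`). -/
theorem e3AtOf_translate (ρ : Fin (d + 1) → ℤ) (hLc : 1 ≤ Lc) (cE cVH cΛ : ℝ) (j : ℕ) (κ' : Fin (d + 1))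
    (u' t' : Fin (d + 1) → ℤ) :
    e3AtOf d Lc ρ cE cVH cΛ (j + 1) κ' (u' + t') = shiftK (-t') (e3AtOf d Lc ρ cE cVH cΛ (j + 1) κ' u') := by
  have hS : ∀ (κ : Fin (d + 1)) (u t : Fin (d + 1) → ℤ),
      ScAt d Lc ρ cE cVH cΛ (j + 1 - 1) κ (u + (((Lc ^ (j + 1) : ℕ) : ℤ)) • t)
        = shiftK (-((((Lc ^ (j + 1) : ℕ) : ℤ)) • t)) (ScAt d Lc ρ cE cVH cΛ (j + 1 - 1) κ u) := by
    rw [Nat.add_sub_cancel]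
    exact ScAt_translate ρ hLc cE cVH cΛ j
  have hV := vertexOf_translate_block (N := Lc ^ (j + 1)) hS κ' u' t'
  have hK := shiftK_KInv (N := Lc ^ (j + 1)) (d := d) t'
  funext x' z' a b
  simp only [e3AtOf, shiftK]
  rw [hV, comp_sandwich_shiftK hK, mmRead_shiftK_smul]
  rfl

/-- [folklore] **(St♭) FOR THE ROOTED STEP STENCILS** `SstepAt ρ (j+1)` (block translations `u ↦ u + Lc•t`). -/
theorem SstepAt_translate (ρ : Fin (d + 1) → ℤ) (hLc : 1 ≤ Lc) (cE cVH cΛ : ℝ) (j : ℕ) (κ' : Fin (d + 1))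
    (u t : Fin (d + 1) → ℤ) :
    SstepAt d Lc ρ cE cVH cΛ (j + 1) κ' (u + (Lc : ℤ) • t) = shiftK (-((Lc : ℤ) • t)) (SstepAt d Lc ρ cE cVH cΛ (j + 1) κ' u) := by
  have h1 := e3AtOf_translate (d := d) ρ hLc cE cVH cΛ j κ' u ((Lc : ℤ) • t)
  have h2 := vhSAt_translate (d := d) ρ hLc κ' u t
  have h3 := SLam_translate (N := Lc) (c := lamCoeffK (KInvStep (d := d) Lc (j + 1)) (E2 d Lc (j + 1)) Lc)
    (Q2 := fun μ y => hessFFAt ρ Lc μ y)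
    (fun μ y κ'' u' t' => lamCoeffK_translate (fun s => shiftK_KInvStep (d := d) (Lc := Lc) (j + 1) s)
      (fun s => shiftK_E2 (d := d) (Lc := Lc) (j + 1) _) μ y κ'' u' t')
    (fun μ y t' => hessFFAt_translate ρ μ y t') κ' u t
  funext x z a b
  simp only [SstepAt, Pi.add_apply, Pi.smul_apply, smul_eq_mul, shiftK]
  rw [h1, h2, mfNeg_shiftK, h3]
  rfl

variable (hLc : 1 ≤ Lc) {r : Fin (d + 1) → ℕ} (hr : r ∈ box (d + 1) Lc) (cE cVH cΛ : ℝ)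
    (W : ℕ → Fin (d + 1) → (Fin (d + 1) → ℤ) → Fin (d + 1) → (Fin (d + 1) → ℤ) → ExpKernelCalculus.MKer (d + 1) (Fib d))
    (Cw δw : ℕ → ℝ) (hδw : ∀ j, 0 < δw j) (hW : ∀ j, VertexFamily₂ (W j) Lc (Cw j) (δw j))

/-- [folklore] **(St♭) FOR `JsBal⁰_ρ`**, every member. -/
theorem JsBal0AtOf_S_translate : ∀ (j : ℕ) (κ' : Fin (d + 1)) (u t : Fin (d + 1) → ℤ),
    (JsBal0AtOf hLc hr cE cVH cΛ W Cw δw hδw hW j).S κ' (u + (Lc : ℤ) • t)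
      = shiftK (-((Lc : ℤ) • t)) ((JsBal0AtOf hLc hr cE cVH cΛ W Cw δw hδw hW j).S κ' u)
  | 0, κ', u, t => by rw [JsBal0AtOf_S_zero]; exact S0At_translate (toSite r) hLc cE cVH cΛ κ' u t
  | j + 1, κ', u, t => by rw [JsBal0AtOf_S_succ]; exact SstepAt_translate (toSite r) hLc cE cVH cΛ j κ' u t

/-- [folklore] **(St♭) FOR `JsBal_ρ = dressAt ρ ∘ JsBal⁰_ρ`**, every member — an2's `AxialDressingRooted.dressAtS_translate`. -/
theorem JsBalAtOf_S_translate (j : ℕ) (κ' : Fin (d + 1)) (u t : Fin (d + 1) → ℤ) :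
    (JsBalAtOf hLc hr cE cVH cΛ W Cw δw hδw hW j).S κ' (u + (Lc : ℤ) • t)
      = shiftK (-((Lc : ℤ) • t)) ((JsBalAtOf hLc hr cE cVH cΛ W Cw δw hδw hW j).S κ' u) := by
  show (dressAt hr (JsBal0AtOf hLc hr cE cVH cΛ W Cw δw hδw hW j)).S κ' (u + (Lc : ℤ) • t)
    = shiftK (-((Lc : ℤ) • t)) ((dressAt hr (JsBal0AtOf hLc hr cE cVH cΛ W Cw δw hδw hW j)).S κ' u)
  rw [dressAt_S, dressAt_S]
  exact dressAtS_translate (toSite r) hLc (JsBal0AtOf_S_translate hLc hr cE cVH cΛ W Cw δw hδw hW j) κ' u t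

/-- [folklore] **(Wt) FOR `JsBal_ρ` FROM (Wt) OF THE TABLES** — an2's `AxialDressingRooted.dressAtW_translate`. -/
theorem JsBalAtOf_W_translate
    (hWt : ∀ (j : ℕ) (μ : Fin (d + 1)) (y : Fin (d + 1) → ℤ) (ν : Fin (d + 1)) (y' t : Fin (d + 1) → ℤ),
      W j μ (y + t) ν (y' + t) = shiftK (-((Lc : ℤ) • t)) (W j μ y ν y'))
    (j : ℕ) (μ : Fin (d + 1)) (y : Fin (d + 1) → ℤ) (ν : Fin (d + 1)) (y' t : Fin (d + 1) → ℤ) :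
    (JsBalAtOf hLc hr cE cVH cΛ W Cw δw hδw hW j).W μ (y + t) ν (y' + t)
      = shiftK (-((Lc : ℤ) • t)) ((JsBalAtOf hLc hr cE cVH cΛ W Cw δw hδw hW j).W μ y ν y') := by
  show (dressAt hr (JsBal0AtOf hLc hr cE cVH cΛ W Cw δw hδw hW j)).W μ (y + t) ν (y' + t)
    = shiftK (-((Lc : ℤ) • t)) ((dressAt hr (JsBal0AtOf hLc hr cE cVH cΛ W Cw δw hδw hW j)).W μ y ν y')
  rw [dressAt_W, dressAt_W, JsBal0AtOf_W]
  exact dressAtW_translate (toSite r) hLc (hWt j) μ y ν y' t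

/-- [folklore] **(Wt) FOR `JsBal⁰_ρ`** from that of the tables. -/
theorem JsBal0AtOf_W_translate
    (hWt : ∀ (j : ℕ) (μ : Fin (d + 1)) (y : Fin (d + 1) → ℤ) (ν : Fin (d + 1)) (y' t : Fin (d + 1) → ℤ),
      W j μ (y + t) ν (y' + t) = shiftK (-((Lc : ℤ) • t)) (W j μ y ν y'))
    (j : ℕ) (μ : Fin (d + 1)) (y : Fin (d + 1) → ℤ) (ν : Fin (d + 1)) (y' t : Fin (d + 1) → ℤ) :
    (JsBal0AtOf hLc hr cE cVH cΛ W Cw δw hδw hW j).W μ (y + t) ν (y' + t)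
      = shiftK (-((Lc : ℤ) • t)) ((JsBal0AtOf hLc hr cE cVH cΛ W Cw δw hδw hW j).W μ y ν y') := by
  rw [JsBal0AtOf_W]
  exact hWt j μ y ν y' t

end Covariance

end Summit.QuantumFields.BalabanUV.Beta.SpineRooted

end
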